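import Literature.NumberTheory.EllipticCurves.OrdinaryReductionKernelCharacterProofs
import Literature.NumberTheory.Automorphic.AdicCompletionResidueCard
import HarnessLib

/-!
# The kernel of reduction `C_v ⊂ E[p^∞]` at a good ordinary place `v ∣ p`, IV: the unramified
# character `φ` of infinite order on `E[p^∞]/C_v` (Greenberg, LNM 1716, §2, pp. 70–71, 76) — PROVED

`Proofs` file (theorems only: no definition, no named fact, no instance, no `sorry`), topic
`NumberTheory/EllipticCurves`; last of four files (`OrdinaryReductionPinnedReductionMapProofs`,
`OrdinaryReductionTorsionCharactersProofs`, `OrdinaryReductionKernelCharacterProofs`) discharging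
the two named facts of `OrdinaryReductionTorsionCharacters`.  It proves the SECOND one:

* `ordinaryReduction_exists_unramified_character_mod_kernelReduction_holds` — **F4b (Greenberg
  LNM 1716 §2: "`E[p^∞]/C_v` is the maximal unramified quotient of `E[p^∞]`", "the action on
  `Ẽ[p^∞]` is by a character `φ`", "`φ` has infinite order")**: at a place `v ∣ p` of good
  ordinary reduction there is a character `φ : Γ_{K_v} → ℤ_pˣ`, trivial on `I_{K_v}`, with
  `φ(σ)ⁿ ≠ 1` for every arithmetic Frobenius `σ` and `n ≥ 1`, such that
  `ι(σ • P - (φ(σ) mod p^k) • P) ∈ E₁(K̄_v)` for every `P ∈ E(K̄)` with `p^k P = 0`.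

## The argument

* §1 **the pinned reduction map in coordinates** (`reductionMap_smul_eq_some`): if the point of
  the minimal model attached to `P` is `(x, y)` with `x` integral, then `f(τ • P)` is the
  reduction of `(τx, τy)` (equivariance of `pointsMap`, `localPointsEquivModel`; `Γ_{K_v}` acts
  by isometries; `reducePoint_some_algebraMap`);
* §2 **infinite order on Frobenius** (`not_forall_reductionMap_pow_smul_eq`): if `σ` is an
  arithmetic Frobenius (`IsFrobPow σ 1`: `|σ z - z^q|_v < 1` on `𝒪_{K̄_v}`, via
  `mem_absMaximalIdeal_iff_algNorm_lt_one` and the dictionary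
  `spectralValuation_lt_one_iff_algNorm_lt_one`; powers by `IsFrobPow.mul_holds`) and `σⁿ`
  acted trivially on `E[p^k]/C_v[p^k]` for all `k`, then every point of
  `MO~(k_w)[p^k] = f(E[p^k])` would have coordinates fixed by `z ↦ z^{qⁿ}` (the reduction of
  `(σⁿx, σⁿy)` is `(x̄^{qⁿ}, ȳ^{qⁿ})`), of which there are at most `1 + q²ⁿ`
  (`FiniteField.X_pow_card_sub_X_natDegree_eq`, `Polynomial.card_roots'`) — but
  `#MO~(k_w)[p^k] = p^k` is unbounded; this is "`φ(Frob_v)` is the unit root `α_v`,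
  `|α_v| = √q_v`" (Serre 1972 §1.11: "`G` opère sur `Ẽ` par l'intermédiaire de `G → G_k`"),
  read through the finiteness of `Ẽ(𝔽_{qⁿ})`;
* §3 F4b: `φ = χ_p · ψ⁻¹` with `ψ` from `exists_character_ker_map`; unramified since `ψ = χ_p`
  on `I_{K_v}`; the torsion clause is `sub_smul_mem_ker_map` read at level `k` (`T_pE ↠ E[p^k]`,
  `proj_surjective_of_isAlgClosed_holds`; `TateModule.proj_smul`), landing in `C_v` by
  `reductionMap_eq_zero_iff_mem_localKernelOfReduction`; infinite order by §2.

## References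

* [GreenbergLNM1716] R. Greenberg, LNM 1716 (1999), §2, pp. 70–71 (p0073), p. 76 (p0079).
* [SerreInventiones1972] J.-P. Serre, Invent. Math. 15 (1972), §1.11 Prop. 11 (proof).
* [SilvermanAEC2009] J. H. Silverman, *AEC* 2nd ed., III.7, III.8.3, V.2.3.1, VII.2.1, VIII.§1.
* [TateCorvallis1979] J. Tate, *Number theoretic background*, §1.4 (Frobenius powers).

## Design

No definitions: `φ` is the term `(χ_p).toMonoidHom * ψ⁻¹` inside the final proof.
`noncomputable section`, `open scoped Classical`.
-/

noncomputable section

open scoped Classical NNReal NumberField TensorProduct AddSubgroup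
open NumberField IsDedekindDomain Polynomial

namespace Literature.NumberTheory.EllipticCurves

open _root_.WeierstrassCurve Literature.NumberTheory.GaloisRepresentations Field
  IsDedekindDomain.HeightOneSpectrum

/-! ## §1–§2 The reduction map in coordinates; infinite order on Frobenius -/

section Frobenius

variable {K : Type} [Field K] [NumberField K] {W : WeierstrassCurve K} [W.IsElliptic]
  {p : ℕ} [hp : Fact p.Prime] {v : HeightOneSpectrum (𝓞 K)}
  {φ : v.adicCompletionIntegers K →+* (v.spectralValuation).valuationSubring}
  (hΔO : IsUnit ((W.localMinimalIntegralModel v).map φ).Δ)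
  (hX : ((W.localMinimalIntegralModel v).map
      (algebraMap (v.adicCompletionIntegers K) (v.adicCompletion K))).baseChange
        (AlgebraicClosure (v.adicCompletion K)) =
      ((W.localMinimalIntegralModel v).map φ).baseChange (AlgebraicClosure (v.adicCompletion K)))
  (f : geomPoints W →+
    (((W.localMinimalIntegralModel v).map φ).map
      (IsLocalRing.residue (v.spectralValuation).valuationSubring)).toAffine.Point)
  (hf : ∀ a, f a = goodReductionHom ((W.localMinimalIntegralModel v).map φ)
    (Valuation.valuationSubring.integers v.spectralValuation) hΔO
    (Affine.Point.congrEquiv hX (W.localPointsEquivModel v (pointsMap W (v.adicCompletion K) a))))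

include hf

omit [W.IsElliptic] hp in
/-- **The pinned reduction map in coordinates, after a Galois conjugation.**  If the point of the
minimal model attached to `P ∈ E(K̄)` is `(x, y)` with `x` integral, then for `τ ∈ Γ_{K_v}` the
point attached to `τ • P` is `(τx, τy)` (equivariance of `pointsMap` and `localPointsEquivModel`),
again integral (`Γ_{K_v}` acts by isometries), and `f(τ • P) = (τx mod 𝔪_w, τy mod 𝔪_w)`
(`reducePoint_some_algebraMap`).  Silverman VII.2.1, VIII.§1. [cite: SilvermanAEC2009, Prop. VII.2.1] -/
theorem reductionMap_smul_eq_some (τ : absoluteGaloisGroup (v.adicCompletion K)) {P : geomPoints W}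
    {x y : AlgebraicClosure (v.adicCompletion K)}
    {hxy : (((W.localMinimalIntegralModel v).map
      (algebraMap (v.adicCompletionIntegers K) (v.adicCompletion K))).baseChange
        (AlgebraicClosure (v.adicCompletion K))).toAffine.Nonsingular x y}
    (hQ : W.localPointsEquivModel v (pointsMap W (v.adicCompletion K) P) = .some x y hxy)
    (hx : v.spectralValuation x ≤ 1) :
    ∃ (hτx : v.spectralValuation (τ • x) ≤ 1) (hτy : v.spectralValuation (τ • y) ≤ 1)
      (hns : ((((W.localMinimalIntegralModel v).map φ).map
        (IsLocalRing.residue (v.spectralValuation).valuationSubring))).toAffine.Nonsingular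
          (IsLocalRing.residue _ ⟨τ • x, hτx⟩) (IsLocalRing.residue _ ⟨τ • y, hτy⟩)),
      f (absGaloisRestrict K (v.adicCompletion K) τ • P) = .some _ _ hns := by
  have hw := coe_spectralValuation v
  have hvO : (v.spectralValuation).Integers (v.spectralValuation).valuationSubring :=
    Valuation.valuationSubring.integers _
  have hinj := hvO.hom_inj
  haveI hMOell : ((W.localMinimalIntegralModel v).map φ).IsElliptic := ⟨hΔO⟩
  haveI := isElliptic_map_residue (W := (W.localMinimalIntegralModel v).map φ) hΔO
  have hxy' : (((W.localMinimalIntegralModel v).map φ).baseChange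
      (AlgebraicClosure (v.adicCompletion K))).toAffine.Nonsingular x y := hX ▸ hxy
  have hy : v.spectralValuation y ≤ 1 := v_Y_le_one_of_v_X_le_one hvO hxy'.1 hx
  have hτx : v.spectralValuation (τ • x) ≤ 1 := by rwa [spectralValuation_smul hw]
  have hτy : v.spectralValuation (τ • y) ≤ 1 := by rwa [spectralValuation_smul hw]
  -- the point attached to `τ • P` is `(τx, τy)`
  have hQτ : W.localPointsEquivModel v (pointsMap W (v.adicCompletion K)
      (absGaloisRestrict K (v.adicCompletion K) τ • P)) =
      Affine.Point.map ((absoluteGaloisGroup.toAlgEquiv (v.adicCompletion K) τ :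
          AlgebraicClosure (v.adicCompletion K) ≃ₐ[v.adicCompletion K]
            AlgebraicClosure (v.adicCompletion K)) :
          AlgebraicClosure (v.adicCompletion K) →ₐ[v.adicCompletion K]
            AlgebraicClosure (v.adicCompletion K)) (.some x y hxy) := by
    rw [← resGal_eq_absGaloisRestrict, pointsMap_smul, localPointsEquivModel_smul, hQ]
  rw [Affine.Point.map_some] at hQτ
  rcases hQτ' : W.localPointsEquivModel v (pointsMap W (v.adicCompletion K)
      (absGaloisRestrict K (v.adicCompletion K) τ • P)) with _ | ⟨a, b, hab⟩
  · rw [hQτ'] at hQτ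
    exact absurd hQτ.symm (Affine.Point.some_ne_zero _)
  · rw [hQτ'] at hQτ
    obtain ⟨rfl, rfl⟩ : a = τ • x ∧ b = τ • y := by
      simpa only [Affine.Point.some.injEq, absoluteGaloisGroup.smul_def, AlgEquiv.coe_toAlgHom]
        using hQτ
    have hab' : (((W.localMinimalIntegralModel v).map φ).baseChange
        (AlgebraicClosure (v.adicCompletion K))).toAffine.Nonsingular
          (algebraMap _ (AlgebraicClosure (v.adicCompletion K))
            (⟨_, hτx⟩ : (v.spectralValuation).valuationSubring))
          (algebraMap _ (AlgebraicClosure (v.adicCompletion K))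
            (⟨_, hτy⟩ : (v.spectralValuation).valuationSubring)) := hX ▸ hab
    have heqO := (map_equation_iff hinj).mp hab'.1
    have hns := (WeierstrassCurve.Affine.equation_iff_nonsingular).mp
      (heqO.map (IsLocalRing.residue (v.spectralValuation).valuationSubring))
    refine ⟨hτx, hτy, hns, ?_⟩
    rw [hf, hQτ', Affine.Point.congrEquiv_some, goodReductionHom_apply]
    exact reducePoint_some_algebraMap hinj hab' hns

variable (hpv : (p : 𝓞 K) ∈ v.asIdeal) (hgood : W.HasGoodReductionAt v)
  (hord : ¬ ((p : ℤ) ∣ W.frobeniusTraceAt v))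

include hpv hgood hord

/-- **A power `σⁿ` (`n ≥ 1`) of an arithmetic Frobenius does not act trivially on `E[p^∞]/C_v`**
(Greenberg LNM 1716 §2 p. 76: "`φ` has infinite order"; Serre 1972 §1.11: "`G` opère sur `Ẽ`
par l'intermédiaire de `G → G_k`").  If `f(σⁿ P) = f(P)` for every `p`-power torsion point `P`,
then every point of `MO~(k_w)[p^k] = f(E[p^k])` has coordinates fixed by `z ↦ z^{qⁿ}` — the
reduction of `(σⁿx, σⁿy)` is `(x̄^{qⁿ}, ȳ^{qⁿ})` because `|σⁿz - z^{qⁿ}|_v < 1` on the integers of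
`K̄_v` (`IsFrobPow`) — so `p^k = #MO~(k_w)[p^k] ≤ 1 + q²ⁿ` for all `k`
(`FiniteField.X_pow_card_sub_X_natDegree_eq`, `Polynomial.card_roots'`), absurd.
[cite: GreenbergLNM1716, §2 p. 76 (held copy p0079: "φ has infinite order")]
[cite: SerreInventiones1972, §1.11 Prop. 11 (proof)] -/
theorem not_forall_reductionMap_pow_smul_eq {σ : absoluteGaloisGroup (v.adicCompletion K)}
    (hσ : IsFrobPow σ 1) {n : ℕ} (hn : 0 < n) :
    ¬ ∀ (k : ℕ), ∀ P ∈ (geomPoints W)[(p ^ k : ℕ)],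
        f (absGaloisRestrict K (v.adicCompletion K) (σ ^ n) • P) = f P := by
  intro H
  have hw := coe_spectralValuation v
  have hvO : (v.spectralValuation).Integers (v.spectralValuation).valuationSubring :=
    Valuation.valuationSubring.integers _
  have hinj := hvO.hom_inj
  haveI hMOell : ((W.localMinimalIntegralModel v).map φ).IsElliptic := ⟨hΔO⟩
  haveI := isElliptic_map_residue (W := (W.localMinimalIntegralModel v).map φ) hΔO
  obtain ⟨-, -, -, hB, hsurj⟩ := reductionMap_stable_invariant_counts hΔO hX f hf hpv hgood hord
  -- the residue cardinality `q ≥ 2` and `m = q ^ n ≥ 2`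
  obtain ⟨q, hq⟩ : ∃ q, q = IsNonarchimedeanLocalField.residueFieldCard (v.adicCompletion K) :=
    ⟨_, rfl⟩
  have hq1 : 1 < q := by
    rw [hq, Literature.NumberTheory.Automorphic.residueFieldCard_adicCompletion_eq]
    exact v.one_lt_residueCard
  obtain ⟨m, hm⟩ : ∃ m, m = q ^ n := ⟨_, rfl⟩
  have hm1 : 1 < m := hm ▸ Nat.one_lt_pow hn.ne' hq1
  -- residues agree when the difference lies in `𝔪_w`
  have hres : ∀ a b : (v.spectralValuation).valuationSubring,
      v.spectralValuation ((a : AlgebraicClosure (v.adicCompletion K)) - b) < 1 →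
      IsLocalRing.residue (v.spectralValuation).valuationSubring a =
        IsLocalRing.residue (v.spectralValuation).valuationSubring b := by
    intro a b hab
    rw [← sub_eq_zero, ← map_sub, IsLocalRing.residue_eq_zero_iff, IsLocalRing.mem_maximalIdeal,
      mem_nonunits_iff, hvO.isUnit_iff_valuation_eq_one]
    exact fun h ↦ absurd h (ne_of_lt (by simpa using hab))
  -- (1) `σ^n` is a Frobenius power of exponent `n`: `|σ^n z - z^m|_v < 1` on integers
  have hpow : ∀ j : ℕ, IsFrobPow (σ ^ j) (j : ℤ) := by
    intro j
    induction j with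
    | zero => rw [pow_zero]; exact IsFrobPow.one
    | succ j ih =>
      rw [pow_succ, Nat.cast_succ]
      exact IsFrobPow.mul_holds ih hσ
  have hFrob : ∀ z : AlgebraicClosure (v.adicCompletion K), v.spectralValuation z ≤ 1 →
      v.spectralValuation ((σ ^ n) • z - z ^ m) < 1 := by
    intro z hz
    have hz' := (IsNonarchimedeanLocalField.mem_absIntegers_iff_algNorm_le_one
      (F := v.adicCompletion K)).mpr ((spectralValuation_le_one_iff_algNorm_le_one hw z).mp hz)
    have h := (isFrobPow_natCast_iff.mp (hpow n)) ⟨z, hz'⟩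
    rw [IsNonarchimedeanLocalField.mem_absMaximalIdeal_iff_algNorm_lt_one, ← hq, ← hm] at h
    rw [spectralValuation_lt_one_iff_algNorm_lt_one hw]
    convert h using 2
    rw [AddSubgroupClass.coe_sub, SubmonoidClass.coe_pow, integralClosure.coe_smul]
  -- (2) the finite set of candidate reductions
  obtain ⟨T, hT, hTcard⟩ : ∃ T : Finset (IsLocalRing.ResidueField (v.spectralValuation).valuationSubring),
      (∀ z, z ^ m = z → z ∈ T) ∧ T.card ≤ m := by
    refine ⟨((X : (IsLocalRing.ResidueField (v.spectralValuation).valuationSubring)[X]) ^ m - X).roots.toFinset,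
      fun z hz ↦ ?_, ?_⟩
    · rw [Multiset.mem_toFinset, mem_roots (FiniteField.X_pow_card_sub_X_ne_zero _ hm1),
        IsRoot.def, eval_sub, eval_pow, eval_X, hz, sub_self]
    · exact (Multiset.toFinset_card_le _).trans
        ((card_roots' _).trans (FiniteField.X_pow_card_sub_X_natDegree_eq _ hm1).le)
  let mk : IsLocalRing.ResidueField (v.spectralValuation).valuationSubring ×
      IsLocalRing.ResidueField (v.spectralValuation).valuationSubring →
      (((W.localMinimalIntegralModel v).map φ).map
        (IsLocalRing.residue (v.spectralValuation).valuationSubring)).toAffine.Point := fun xy ↦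
    if h : (((W.localMinimalIntegralModel v).map φ).map
        (IsLocalRing.residue (v.spectralValuation).valuationSubring)).toAffine.Nonsingular xy.1 xy.2
    then .some xy.1 xy.2 h else 0
  obtain ⟨F, hF, hFcard⟩ : ∃ F : Finset (((W.localMinimalIntegralModel v).map φ).map
      (IsLocalRing.residue (v.spectralValuation).valuationSubring)).toAffine.Point,
      F = insert 0 ((T ×ˢ T).image mk) ∧ F.card ≤ 1 + m * m := by
    refine ⟨_, rfl, ?_⟩
    rw [add_comm]
    refine (Finset.card_insert_le _ _).trans (Nat.add_le_add_right ?_ 1)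
    refine Finset.card_image_le.trans ?_
    rw [Finset.card_product]
    exact Nat.mul_le_mul hTcard hTcard
  -- (3) every point of `MO~[p^k]` lies in `F`
  have hsub : ∀ k, ∀ b ∈ ((((W.localMinimalIntegralModel v).map φ).map
      (IsLocalRing.residue (v.spectralValuation).valuationSubring)).toAffine.Point)[(p ^ k : ℕ)],
      b ∈ F := by
    intro k b hb
    obtain ⟨P, hP, rfl⟩ := hsurj k b hb
    rcases hQ : W.localPointsEquivModel v (pointsMap W (v.adicCompletion K) P) with _ | ⟨x, y, hxy⟩
    · have h0 : f P = 0 := by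
        rw [hf, hQ, ← Affine.Point.zero_def, Affine.Point.congrEquiv_zero, map_zero]
      rw [h0, hF]; exact Finset.mem_insert_self _ _
    · by_cases hx : v.spectralValuation x ≤ 1
      · -- integral point: `f P = (x̄, ȳ)` and `f (σⁿ P) = ((σⁿx)‾, (σⁿy)‾) = (x̄^m, ȳ^m)`
        obtain ⟨hx1, hy1, hns1, h1⟩ := reductionMap_smul_eq_some hΔO hX f hf 1 hQ hx
        obtain ⟨hxτ, hyτ, hnsτ, hτ⟩ := reductionMap_smul_eq_some hΔO hX f hf (σ ^ n) hQ hx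
        rw [map_one, one_smul] at h1
        have hPτ := H k P hP
        rw [hτ, h1] at hPτ
        obtain ⟨hxe, hye⟩ :
            IsLocalRing.residue (v.spectralValuation).valuationSubring ⟨(σ ^ n) • x, hxτ⟩ =
              IsLocalRing.residue (v.spectralValuation).valuationSubring
                ⟨(1 : absoluteGaloisGroup (v.adicCompletion K)) • x, hx1⟩ ∧
            IsLocalRing.residue (v.spectralValuation).valuationSubring ⟨(σ ^ n) • y, hyτ⟩ =
              IsLocalRing.residue (v.spectralValuation).valuationSubring
                ⟨(1 : absoluteGaloisGroup (v.adicCompletion K)) • y, hy1⟩ := by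
          simpa only [Affine.Point.some.injEq] using hPτ
        have hxm : v.spectralValuation (x ^ m) ≤ 1 := by rw [map_pow]; exact pow_le_one₀ zero_le hx
        have hym : v.spectralValuation (y ^ m) ≤ 1 := by
          rw [map_pow]; exact pow_le_one₀ zero_le (by simpa only [one_smul] using hy1)
        have hxfix : IsLocalRing.residue (v.spectralValuation).valuationSubring ⟨_, hx1⟩ ^ m =
            IsLocalRing.residue (v.spectralValuation).valuationSubring ⟨_, hx1⟩ :=
          calc IsLocalRing.residue (v.spectralValuation).valuationSubring ⟨_, hx1⟩ ^ m
              = IsLocalRing.residue (v.spectralValuation).valuationSubring ⟨x ^ m, hxm⟩ := by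
                rw [← map_pow]
                exact congrArg _ (Subtype.ext (by simp only [SubmonoidClass.mk_pow, one_smul]))
            _ = IsLocalRing.residue (v.spectralValuation).valuationSubring ⟨(σ ^ n) • x, hxτ⟩ :=
                (hres _ _ (hFrob x hx)).symm
            _ = _ := hxe
        have hyfix : IsLocalRing.residue (v.spectralValuation).valuationSubring ⟨_, hy1⟩ ^ m =
            IsLocalRing.residue (v.spectralValuation).valuationSubring ⟨_, hy1⟩ :=
          calc IsLocalRing.residue (v.spectralValuation).valuationSubring ⟨_, hy1⟩ ^ m
              = IsLocalRing.residue (v.spectralValuation).valuationSubring ⟨y ^ m, hym⟩ := by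
                rw [← map_pow]
                exact congrArg _ (Subtype.ext (by simp only [SubmonoidClass.mk_pow, one_smul]))
            _ = IsLocalRing.residue (v.spectralValuation).valuationSubring ⟨(σ ^ n) • y, hyτ⟩ :=
                (hres _ _ (hFrob y (by simpa only [one_smul] using hy1))).symm
            _ = _ := hye
        rw [h1, hF, Finset.mem_insert]
        refine Or.inr (Finset.mem_image.mpr ⟨(_, _), Finset.mk_mem_product (hT _ hxfix) (hT _ hyfix), ?_⟩)
        exact dif_pos hns1
      · -- non-integral `x`: `f P = 0`
        have h0 : f P = 0 := by
          rw [hf, hQ, Affine.Point.congrEquiv_some, goodReductionHom_apply]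
          exact reducePoint_some_of_not_mem _ ((not_mem_range_iff hvO).mpr (not_le.mp hx))
        rw [h0, hF]; exact Finset.mem_insert_self _ _
  -- (4) counting: `p^k ≤ 1 + m²` for all `k`
  have hle : ∀ k, p ^ k ≤ 1 + m * m := by
    intro k
    have h1 : Nat.card ↥((((W.localMinimalIntegralModel v).map φ).map
        (IsLocalRing.residue (v.spectralValuation).valuationSubring)).toAffine.Point[(p ^ k : ℕ)]) ≤
        Nat.card ↥F := by
      refine Nat.card_le_card_of_injective (fun b ↦ (⟨b.1, hsub k b.1 b.2⟩ : ↥F)) fun b b' h ↦ ?_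
      have h' := congrArg Subtype.val h
      exact Subtype.ext (by simpa using h')
    rw [hB k, one_mul, Nat.card_eq_finsetCard] at h1
    exact h1.trans hFcard
  exact absurd (hle (1 + m * m)) (not_le.mpr (Nat.lt_pow_self hp.out.one_lt))

end Frobenius

/-! ## §3 F4b: the unramified character `φ` of infinite order on `E[p^∞]/C_v` -/

/-- **Greenberg, LNM 1716 §2 (pp. 70–71, 76), PROVED: at a place `v ∣ p` of good ORDINARY
reduction "`E[p^∞]/C_v` is the maximal unramified quotient", "the action on `Ẽ[p^∞]` is by a
character `φ`", and "`φ` has infinite order"** — discharge of the named fact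
`Literature.NumberTheory.EllipticCurves.ordinaryReduction_exists_unramified_character_mod_kernelReduction`.
The character is `φ = χ_p · ψ⁻¹` with `ψ` the character of `Γ_{K_v}` on `T_p(C_v)`
(`exists_character_ker_map`); it is trivial on `I_{K_v}` because `ψ = χ_p` there (Part II);
`σ x - φ(σ) x ∈ T_p(C_v)` on `T_pE` (`sub_smul_mem_ker_map`) read at level `k` gives
`ι(σ P - (φ(σ) mod p^k) P) ∈ E₁(K̄_v)`; and `φ(σ)ⁿ = 1` for an arithmetic Frobenius `σ` would
make `σⁿ` act trivially on `E[p^∞]/C_v`, against `not_forall_reductionMap_pow_smul_eq`.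
[cite: GreenbergLNM1716, §2 pp. 70–71 (held copy p0073: "E[p^∞]/C_v is the maximal unramified quotient"); §2 p. 76 (p0079: "the action on Ẽ[p^∞] is by a character φ … φ has infinite order")]
[cite: SerreInventiones1972, §1.11 Prop. 11 and Cor.] [cite: SilvermanAEC2009, Prop. III.8.3, Prop. VII.2.1] -/
theorem ordinaryReduction_exists_unramified_character_mod_kernelReduction_holds :
    ordinaryReduction_exists_unramified_character_mod_kernelReduction := by
  intro K _ _ W _ p _ v hpv hgood hord
  -- the pinned setup and its reduction map `f`
  obtain ⟨φ, -, hΔO, hX⟩ := exists_pinnedSetup W v hgood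
  have hvO : (v.spectralValuation).Integers (v.spectralValuation).valuationSubring :=
    Valuation.valuationSubring.integers _
  set f : geomPoints W →+ (((W.localMinimalIntegralModel v).map φ).map
      (IsLocalRing.residue (v.spectralValuation).valuationSubring)).toAffine.Point :=
    (goodReductionHom ((W.localMinimalIntegralModel v).map φ) hvO hΔO).comp
      (((Affine.Point.congrEquiv hX).toAddMonoidHom.comp
        (W.localPointsEquivModel v).toAddMonoidHom).comp (pointsMap W (v.adicCompletion K)))
    with hfdef
  have hf : ∀ a, f a = goodReductionHom ((W.localMinimalIntegralModel v).map φ) hvO hΔO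
      (Affine.Point.congrEquiv hX (W.localPointsEquivModel v (pointsMap W (v.adicCompletion K) a))) :=
    fun _ ↦ rfl
  obtain ⟨ψ, hψ, hψI⟩ := exists_character_ker_map hΔO hX f hf hpv hgood hord
  refine ⟨(GaloisRep.cyclotomicCharacter (v.adicCompletion K) p).toMonoidHom * ψ⁻¹,
    fun τ hτ ↦ ?_, fun σ hσ n hn hcontra ↦ ?_, fun σ k P hP ↦ ?_⟩
  · -- unramified
    rw [MonoidHom.mul_apply, MonoidHom.inv_apply, hψI τ hτ]
    exact mul_inv_cancel _
  · -- infinite order on Frobenius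
    refine not_forall_reductionMap_pow_smul_eq hΔO hX f hf hpv hgood hord hσ hn fun k P hPk ↦ ?_
    obtain ⟨x, rfl⟩ := W.proj_surjective_of_isAlgClosed_holds p k (P := P) hPk
    have hmem := sub_smul_mem_ker_map hΔO hX f hf hpv hgood hord ψ hψ (σ ^ n) x
    have hone : (GaloisRep.cyclotomicCharacter (v.adicCompletion K) p (σ ^ n) * (ψ (σ ^ n))⁻¹ :
        ℤ_[p]ˣ) = 1 := by
      have h := hcontra
      rw [← map_pow, MonoidHom.mul_apply, MonoidHom.inv_apply] at h
      exact h
    rw [hone, Units.val_one, one_smul] at hmem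
    have h := LinearMap.mem_ker.mp hmem
    rw [map_sub, sub_eq_zero] at h
    have h' := congrArg (TateModule.proj p k) h
    rw [TateModule.proj_map, TateModule.proj_map, TateModule.proj_smul_of_distribMulAction] at h'
    exact h'
  · -- the torsion clause
    have hPk : P ∈ geomTorsion W (p ^ k : ℕ) := AddSubgroup.torsionBy.nsmul_iff.mpr hP
    obtain ⟨x, rfl⟩ := W.proj_surjective_of_isAlgClosed_holds p k (P := P) hPk
    have hmem := sub_smul_mem_ker_map hΔO hX f hf hpv hgood hord ψ hψ σ x
    refine (reductionMap_eq_zero_iff_mem_localKernelOfReduction W v hΔO hX f hf _).mp ?_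
    have h := LinearMap.mem_ker.mp hmem
    have h' := congrArg (TateModule.proj p k) h
    rw [TateModule.proj_map, map_zero, map_sub, TateModule.proj_smul_of_distribMulAction,
      TateModule.proj_smul] at h'
    rw [MonoidHom.mul_apply, MonoidHom.inv_apply]
    exact h'

end Literature.NumberTheory.EllipticCurves

end
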